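import Literature.Analysis.FluidPDE.HeatDivFormGradientL2
import HarnessLib

/-!
# ScalingDefectPeepholeDoorSerrinSlab — door S30 «ScalingDefectPeepholeDoor», effective plate E0 (step E1b):
# the slab integral of the Duhamel energy density and the pairing bound

Door S30 (`Theorems/ScalingDefectPeepholeDoorDefs.lean`) is closed by name (`targetVortexDefectPeephole_holds`,
p620717); its LEG Cω `quietVortexCoreRigidity_holds` produces the lateness `s₁` AFTER the annular pressure
level `C_p`, because the one-slice derivative bounds it consumes
(`Literature.Analysis.FluidPDE.exists_forall_iteratedFDeriv_le_of_typeI_of_bounds`) hold below a scale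
`c₁(B_u, B_p)` that depends on the pressure.  The effective order `QuietVortexCoreRigidityU`
(nsreg-p1 g25, Sketch31 v2.1 Part B; ADDENDUM-28A: "the vorticity-side envelopes are pressure-free,
Serrin 1962") needs interior derivative bounds for bounded solutions that never read the pressure
(Serrin 1962; Chen–Strain–Tsai–Yau 2009, Lemma A.2; Pineau–Vicol 2026, Lemma 9.1).  The chain
`…SerrinPointwise` → `…SerrinSlab` → `…SerrinSpinDuality` → `…SerrinSpinL2` supplies the missing `L²`
START of Serrin's bootstrap (the tree's `NSBootstrap.spin_bound_backward_quant` / `level_step` are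
already pressure-free) by DUALITY with the backward caloric Duhamel integral `𝒰[ξ]`, one derivative
below the tree's `HeatDivForm.heatDivForm_gradient_L2_top`.

This file: `∫∫_{]-L,0[×E} (|U|² + Σᵢ|∂ᵢU|² + Σᵢⱼ|∂ⱼ∂ᵢU|²) ≤ (4L² + 2L + n) ‖ξ‖₂²` for `U = 𝒰[ξ]`
(`IsSpaceTimeTestOn.energy_estimate_zero/one`), and the Cauchy–Schwarz pairing of an a.e. bounded
function supported in a finite-measure subset of the slab with a continuous factor dominated by that
density.

Door S30 is a regularity CRITERION inside a HYPOTHETICAL local Type-I blow-up; item 0056 `NoTypeII`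
stays OPEN; nothing here bears on NS regularity itself.
-/

noncomputable section

set_option linter.dupNamespace false

namespace Summit.NavierStokesRegularity.NavierStokesRegularity.Theorems.ScalingDefectPeepholeDoor

namespace Serrin

open MeasureTheory Set Function Filter Topology TopologicalSpace Metric InnerProductSpace
open scoped NNReal ENNReal RealInnerProductSpace Laplacian ContDiff
open Literature.Analysis Literature.Analysis.FluidPDE

variable {E : Type*} [NormedAddCommGroup E] [InnerProductSpace ℝ E] [FiniteDimensional ℝ E]
  [MeasurableSpace E] [BorelSpace E]

/-! ### The slab integral of the Duhamel energy density -/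


/-- **Energy density of `𝒰[ξ]` on a slab.** For a global test field `ξ` with time support in
`[a₀, b₀]`, `b₀ ≤ 0`, and `L > 0`, the density
`e = |U|² + Σᵢ|∂ᵢU|² + Σᵢⱼ|∂ⱼ∂ᵢU|²` of `U = 𝒰[ξ]` is integrable on the slab `]-L, 0[ × E` with
`∫∫ e ≤ (4L² + 2L + n) ∫∫ |ξ|²` (`IsSpaceTimeTestOn.energy_estimate_zero/one`). [folklore] -/
theorem slab_energy_le {ξ : ℝ → E → ℝ} (hξ : IsSpaceTimeTestOn (⊤ : Opens (ℝ × E)) ξ)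
    {a₀ b₀ : ℝ} (hab : ∀ t, t ∉ Icc a₀ b₀ → ξ t = 0) (hb₀ : b₀ ≤ 0) {L : ℝ} (hL : 0 < L) :
    Integrable (fun p : ℝ × E => ‖heatDuhamelBack 1 ξ p.1 p.2‖ ^ 2 +
        ∑ i, ‖fderiv ℝ (heatDuhamelBack 1 ξ p.1) p.2 (stdOrthonormalBasis ℝ E i)‖ ^ 2 +
        ∑ i, ∑ j, ‖fderiv ℝ (fun y => fderiv ℝ (heatDuhamelBack 1 ξ p.1) y
          (stdOrthonormalBasis ℝ E i)) p.2 (stdOrthonormalBasis ℝ E j)‖ ^ 2)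
        ((volume.restrict (Ioo (-L) 0)).prod (volume : Measure E)) ∧
      ∫ p, (‖heatDuhamelBack 1 ξ p.1 p.2‖ ^ 2 +
        ∑ i, ‖fderiv ℝ (heatDuhamelBack 1 ξ p.1) p.2 (stdOrthonormalBasis ℝ E i)‖ ^ 2 +
        ∑ i, ∑ j, ‖fderiv ℝ (fun y => fderiv ℝ (heatDuhamelBack 1 ξ p.1) y
          (stdOrthonormalBasis ℝ E i)) p.2 (stdOrthonormalBasis ℝ E j)‖ ^ 2)
          ∂((volume.restrict (Ioo (-L) 0)).prod (volume : Measure E)) ≤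
        (4 * L ^ 2 + 2 * L + (Module.finrank ℝ E : ℝ)) * ∫ q : ℝ × E, ‖ξ q.1 q.2‖ ^ 2 := by
  set U := heatDuhamelBack 1 ξ with hU
  set μS : Measure (ℝ × E) := (volume.restrict (Ioo (-L) 0)).prod (volume : Measure E) with hμS
  have hL0 : (-L : ℝ) ≤ 0 := by linarith
  obtain ⟨hI0, hE0⟩ := HeatDivForm.integral_sq_norm_heatDuhamelBack_slab' hξ one_pos (-L) 0
  obtain ⟨hI1, hE1⟩ := HeatDivForm.integral_sum_sq_norm_fderiv_heatDuhamelBack_slab' hξ one_pos hL0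
  obtain ⟨hI2, hE2⟩ := HeatDivForm.integral_sum_sum_sq_norm_fderiv_fderiv_heatDuhamelBack_slab' hξ one_pos hL0
  obtain ⟨hIξ, hEξ⟩ := HeatDivForm.integral_sq_norm_slab' hξ hL0
  have hen0 := hξ.energy_estimate_zero one_pos hab (τ₀ := -L) (T := 0) hL0 hb₀
  have hen1 := hξ.energy_estimate_one one_pos hab (τ₀ := -L) (T := 0) hL0 hb₀
  obtain ⟨Q, hQ⟩ : ∃ Q : ℝ, Q = ∫ s in (-L)..0, ∫ x, ‖ξ s x‖ ^ 2 := ⟨_, rfl⟩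
  obtain ⟨Iξ, hIξ_def⟩ : ∃ I : ℝ, I = ∫ q : ℝ × E, ‖ξ q.1 q.2‖ ^ 2 := ⟨_, rfl⟩
  rw [← hQ] at hen0 hen1 hEξ
  rw [← hIξ_def]
  have hQI : Q ≤ Iξ := by
    rw [← hEξ, hIξ_def, ← HeatDivForm.restrict_slab_eq_prod]
    refine setIntegral_le_integral ?_ (Eventually.of_forall fun q => by positivity)
    exact (hξ.contDiff.continuous.memLp_of_hasCompactSupport
      hξ.hasCompactSupport (p := 2)).integrable_sq.congr (Eventually.of_forall fun q => by
        show uncurry ξ q ^ 2 = ‖ξ q.1 q.2‖ ^ 2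
        rw [Real.norm_eq_abs, sq_abs]; rfl)
  have hQ0 : 0 ≤ Q := by rw [← hEξ]; exact integral_nonneg fun _ => by positivity
  have hI01 : Integrable (fun p : ℝ × E => ‖U p.1 p.2‖ ^ 2 +
      ∑ i, ‖fderiv ℝ (U p.1) p.2 (stdOrthonormalBasis ℝ E i)‖ ^ 2) μS := hI0.add hI1
  have hI012 : Integrable (fun p : ℝ × E => ‖U p.1 p.2‖ ^ 2 +
      ∑ i, ‖fderiv ℝ (U p.1) p.2 (stdOrthonormalBasis ℝ E i)‖ ^ 2 +
      ∑ i, ∑ j, ‖fderiv ℝ (fun y => fderiv ℝ (U p.1) y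
        (stdOrthonormalBasis ℝ E i)) p.2 (stdOrthonormalBasis ℝ E j)‖ ^ 2) μS := hI01.add hI2
  refine ⟨hI012, ?_⟩
  rw [integral_add hI01 hI2, integral_add hI0 hI1]
  -- zeroth order: `∫_slab |U|² ≤ 4L²Q`
  have h0 : ∫ p, ‖U p.1 p.2‖ ^ 2 ∂μS ≤ 4 * L ^ 2 * Q := by
    rw [hE0]
    have hslice : ∀ s ∈ Ioc (-L) 0, ∫ x, ‖U s x‖ ^ 2 ≤ 4 * (0 - -L) * Q := fun s hs =>
      hen0.1 s ⟨hs.1.le, hs.2⟩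
    calc ∫ s in Ioc (-L) 0, ∫ x, ‖U s x‖ ^ 2
        ≤ ∫ s in Ioc (-L) 0, 4 * (0 - -L) * Q := by
          refine setIntegral_mono_on ?_ (integrableOn_const (by simp [Real.volume_Ioc]))
            measurableSet_Ioc hslice
          have h := hI0.integral_prod_left
          rw [restrict_Ioo_eq_restrict_Ioc] at h
          exact h
      _ = 4 * L ^ 2 * Q := by
          rw [setIntegral_const, smul_eq_mul, Real.volume_real_Ioc_of_le hL0]; ring
  have h1 : ∫ p, ∑ i, ‖fderiv ℝ (U p.1) p.2 (stdOrthonormalBasis ℝ E i)‖ ^ 2 ∂μS ≤ 2 * L * Q := by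
    rw [hE1]
    have : 2 * (0 - -L) / 1 * Q = 2 * L * Q := by ring
    rw [← this]; exact hen0.2
  have h2 : ∫ p, ∑ i, ∑ j, ‖fderiv ℝ (fun y => fderiv ℝ (U p.1) y (stdOrthonormalBasis ℝ E i)) p.2
      (stdOrthonormalBasis ℝ E j)‖ ^ 2 ∂μS ≤ (Module.finrank ℝ E : ℝ) * Q := by
    rw [hE2]
    have : (Module.finrank ℝ E : ℝ) / 1 ^ 2 * Q = (Module.finrank ℝ E : ℝ) * Q := by ring
    rw [← this]; exact hen1
  have hn0 : 0 ≤ (Module.finrank ℝ E : ℝ) := Nat.cast_nonneg _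
  calc ∫ p, ‖U p.1 p.2‖ ^ 2 ∂μS + ∫ p, ∑ i, ‖fderiv ℝ (U p.1) p.2 (stdOrthonormalBasis ℝ E i)‖ ^ 2 ∂μS +
        ∫ p, ∑ i, ∑ j, ‖fderiv ℝ (fun y => fderiv ℝ (U p.1) y (stdOrthonormalBasis ℝ E i)) p.2
          (stdOrthonormalBasis ℝ E j)‖ ^ 2 ∂μS
      ≤ 4 * L ^ 2 * Q + 2 * L * Q + (Module.finrank ℝ E : ℝ) * Q := add_le_add (add_le_add h0 h1) h2
    _ = (4 * L ^ 2 + 2 * L + (Module.finrank ℝ E : ℝ)) * Q := by ring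
    _ ≤ (4 * L ^ 2 + 2 * L + (Module.finrank ℝ E : ℝ)) * Iξ := by
        exact mul_le_mul_of_nonneg_left hQI (by positivity)

/-- **Slab Cauchy–Schwarz with a dominated continuous factor.** If `P ∈ L²(ℝ × E)` vanishes off the
slab `]-L, 0[ × E`, `D` is continuous with `|D|² ≤ c · e` pointwise for an integrable `e ≥ 0` on the
slab with `∫∫ e ≤ S`, then `|∫ P D| ≤ ‖P‖₂ √c √S`. [folklore] -/
theorem abs_integral_mul_le_of_dominated {L : ℝ} {P D e : ℝ × E → ℝ}
    (hP : MemLp P 2 (volume : Measure (ℝ × E))) (hP0 : ∀ q : ℝ × E, q.1 ∉ Ioo (-L) 0 → P q = 0)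
    (hD : Continuous D)
    (he : Integrable e ((volume.restrict (Ioo (-L) 0)).prod (volume : Measure E)))
    {c S : ℝ} (hc : 0 ≤ c) (hDe : ∀ q, ‖D q‖ ^ 2 ≤ c * e q)
    (hS : ∫ q, e q ∂((volume.restrict (Ioo (-L) 0)).prod (volume : Measure E)) ≤ S) :
    |∫ q, P q * D q| ≤ (eLpNorm P 2 (volume : Measure (ℝ × E))).toReal * (Real.sqrt c * Real.sqrt S) := by
  set μS : Measure (ℝ × E) := (volume.restrict (Ioo (-L) 0)).prod (volume : Measure E) with hμS
  have hD2 : Integrable (fun q => ‖D q‖ ^ 2) μS := by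
    refine (he.const_mul c).mono' ((hD.norm.pow 2).aestronglyMeasurable) (Eventually.of_forall fun q => ?_)
    rw [Real.norm_eq_abs, abs_of_nonneg (by positivity)]
    exact hDe q
  have h0 : ∀ q : ℝ × E, q.1 ∉ Ioo (-L) 0 → P q * D q = 0 := fun q hq => by rw [hP0 q hq, zero_mul]
  refine (HeatDivForm.abs_integral_mul_le_of_slab hP hD hD2 h0).trans ?_
  refine mul_le_mul_of_nonneg_left ?_ ENNReal.toReal_nonneg
  have hSe : ∫ q, ‖D q‖ ^ 2 ∂μS ≤ c * S := by
    calc ∫ q, ‖D q‖ ^ 2 ∂μS ≤ ∫ q, c * e q ∂μS := integral_mono hD2 (he.const_mul c) hDe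
      _ = c * ∫ q, e q ∂μS := integral_const_mul _ _
      _ ≤ c * S := mul_le_mul_of_nonneg_left hS hc
  calc Real.sqrt (∫ q, ‖D q‖ ^ 2 ∂μS) ≤ Real.sqrt (c * S) := Real.sqrt_le_sqrt hSe
    _ = Real.sqrt c * Real.sqrt S := Real.sqrt_mul hc S


/-- **`L²` data from a bounded function on a set of finite measure**: the extension by zero of a
function a.e. bounded by `K` on a measurable set `S` of finite measure is in `L²` with
`‖·‖₂ ≤ μ(S)^{1/2} K`. [folklore] -/
theorem memLp_indicator_of_ae_bound {X : Type*} [MeasurableSpace X] {μ : Measure X} {S : Set X}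
    (hS : MeasurableSet S) (hSfin : μ S < ⊤) {f : X → ℝ} (hf : AEStronglyMeasurable f (μ.restrict S))
    {K : ℝ} (hK : ∀ᵐ q ∂(μ.restrict S), ‖f q‖ ≤ K) :
    MemLp (S.indicator f) 2 μ ∧
      eLpNorm (S.indicator f) 2 μ ≤ (μ S) ^ (1 / 2 : ℝ) * ENNReal.ofReal K := by
  haveI : IsFiniteMeasure (μ.restrict S) := isFiniteMeasure_restrict.2 hSfin.ne
  have hm : MemLp f 2 (μ.restrict S) := (memLp_top_of_bound hf K hK).mono_exponent le_top
  refine ⟨(memLp_indicator_iff_restrict hS).2 hm, ?_⟩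
  rw [eLpNorm_indicator_eq_eLpNorm_restrict hS]
  refine (eLpNorm_le_of_ae_bound hK).trans (le_of_eq ?_)
  rw [Measure.restrict_apply_univ]
  norm_num

/-- **The pairing bound of the duality argument.** Let `S ⊆ ]-L, 0[ × E` be measurable of finite
measure, `f` a.e. bounded by `K ≥ 0` on `S`, `D` continuous and vanishing off `S` with
`|D|² ≤ c · e` pointwise for an integrable density `e` on the slab with `∫∫ e ≤ S₀`. Then
`|∫ D f| ≤ vol(S)^{1/2} K √c √S₀`. [folklore] -/
theorem abs_integral_test_mul_bounded_le {L : ℝ} {S : Set (ℝ × E)} (hS : MeasurableSet S)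
    (hSfin : volume S < ⊤) (hSL : ∀ q ∈ S, q.1 ∈ Ioo (-L) 0)
    {f : ℝ × E → ℝ} (hf : AEStronglyMeasurable f (volume.restrict S)) {K : ℝ} (hK : 0 ≤ K)
    (hfK : ∀ᵐ q ∂(volume.restrict S), ‖f q‖ ≤ K)
    {D e : ℝ × E → ℝ} (hD : Continuous D) (hD0 : ∀ q, q ∉ S → D q = 0)
    (he : Integrable e ((volume.restrict (Ioo (-L) 0)).prod (volume : Measure E)))
    {c S₀ : ℝ} (hc : 0 ≤ c) (hDe : ∀ q, ‖D q‖ ^ 2 ≤ c * e q)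
    (hS₀ : ∫ q, e q ∂((volume.restrict (Ioo (-L) 0)).prod (volume : Measure E)) ≤ S₀) :
    |∫ q, D q * f q| ≤ ((volume S) ^ (1 / 2 : ℝ)).toReal * K * (Real.sqrt c * Real.sqrt S₀) := by
  obtain ⟨hPm, hPn⟩ := memLp_indicator_of_ae_bound hS hSfin hf hfK
  have e1 : (fun q => D q * f q) = fun q => S.indicator f q * D q := by
    funext q
    by_cases hq : q ∈ S
    · rw [indicator_of_mem hq, mul_comm]
    · rw [hD0 q hq, indicator_of_notMem hq, zero_mul, mul_zero]
  have hoff : ∀ q : ℝ × E, q.1 ∉ Ioo (-L) 0 → S.indicator f q = 0 := fun q hq =>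
    indicator_of_notMem (fun h => hq (hSL q h)) _
  rw [e1]
  refine (abs_integral_mul_le_of_dominated hPm hoff hD he hc hDe hS₀).trans ?_
  refine mul_le_mul_of_nonneg_right ?_ (by positivity)
  have hVfin : (volume S) ^ (1 / 2 : ℝ) ≠ ⊤ := ENNReal.rpow_ne_top_of_nonneg (by norm_num) hSfin.ne
  calc (eLpNorm (S.indicator f) 2 volume).toReal
      ≤ ((volume S) ^ (1 / 2 : ℝ) * ENNReal.ofReal K).toReal :=
        ENNReal.toReal_mono (ENNReal.mul_ne_top hVfin ENNReal.ofReal_ne_top) hPn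
    _ = ((volume S) ^ (1 / 2 : ℝ)).toReal * K := by rw [ENNReal.toReal_mul, ENNReal.toReal_ofReal hK]

end Serrin

end Summit.NavierStokesRegularity.NavierStokesRegularity.Theorems.ScalingDefectPeepholeDoor

end
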